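import Summits.CriticalPhenomena.PercolationContinuityZ3.Theorems.PercNearOneGluingNoHeavyLowerTailSahiE3ExchangeCross
import Summits.CriticalPhenomena.PercolationContinuityZ3.Theorems.PercNearOneGluingNoHeavyLowerTailSahiE3ExchangeEmptyLayer
import Summits.CriticalPhenomena.PercolationContinuityZ3.Theorems.PercNearOneGluingNoHeavyLowerTailSahiE3ExchangeEmptyLayerPrimed
import Summits.CriticalPhenomena.PercolationContinuityZ3.Theorems.PercNearOneGluingNoHeavyLowerTailSahiE3AndOrBlock
import Mathlib.Tactic
import HarnessLib
import HarnessLib.Audit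

/-!
# `NoHeavyLowerTail` (crux stmt-CriticalPhenomena-4575), Sahi programme P4: flagship block `x₀∧(x₁∨x₂)`, level-`∅` exchange lemma (bracket type 1, i.e. `D₁`) — generic branches (empty layers, no crossing)

Generated support file (cell `prim-l12`, seat P4, generation 23; generator HOME prim-l12-p4/code/gen23/asm/genasm.py;
`--supports stmt-CriticalPhenomena-4575`; tool lemmas of `…SahiE3AndOrTools` inlined in generation 26).  No named facts, no sorries; standard axioms; def-free.
The level-`∅` exchange inequality `EXCH ≥ 0` (bracket type as in the title) of the OR-peel for the block `V = x₀∧(x₁∨x₂) ⊂ Bool³` (product weight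
`μ = (A|1−A)(b|1−b)(c|1−c)`), for every configuration of up-sets `O ⊆ K∩L`, `K∪L ⊆ P` (and primed) and every certificate `R ≥ 0`
satisfying the pair inequalities of all admissible pairs (`hRpair`), is assembled by a case split on the traces `X ∩ V`
(memo FROM-prim-l12-p4-gen23-FLAGSHIP-LEVEL0.md §6): empty layers → `exchange_of_emptyLayer*`, no crossing →
`exchange_of_noCross₂/₁`, crossing with all four traces non-empty (60 patterns) → `exchange_of_hats` at the saturations + the trace
polynomial `andorPolyNN_nonneg` (corners handled through `O ⊆ K∩L`).
-/

set_option maxRecDepth 400000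
set_option linter.unusedSimpArgs false

namespace Summit.CriticalPhenomena.PercolationContinuityZ3.Theorems.SahiE3AndOrExch1

open Finset
open Summit.CriticalPhenomena.PercolationContinuityZ3.Theorems.SahiE3AndOrBlock
open scoped BigOperators
open Summit.CriticalPhenomena.PercolationContinuityZ3.Theorems.SahiE3ExchangeCross
open Summit.CriticalPhenomena.PercolationContinuityZ3.Theorems.SahiE3ExchangeEmptyLayer
open Summit.CriticalPhenomena.PercolationContinuityZ3.Theorems.SahiE3ExchangeEmptyLayerPrimed

/-- Generic non-crossing branch of the flagship level-`∅` assembly (type {TAU}): `exchange_of_noCross₂` with the raw cross pairs. -/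
theorem br1_noCross (A b c : ℝ) (hA0 : 0 ≤ A) (hA1 : A ≤ 1) (hb0 : 0 ≤ b) (hb1 : b ≤ 1) (hc0 : 0 ≤ c) (hc1 : c ≤ 1)
    (μ : (Fin 3 → Bool) → ℝ) (hμ : ∀ x, μ x = (if x 0 then A else 1 - A) * ((if x 1 then b else 1 - b) * (if x 2 then c else 1 - c)))
    (R : (Fin 3 → Bool) → ℝ) (hR0 : ∀ x, 0 ≤ R x)
    (hRpair : ∀ X Y : Finset (Fin 3 → Bool), (∀ a ∈ X, ∀ b : Fin 3 → Bool, a ≤ b → b ∈ X) → (∀ a ∈ Y, ∀ b : Fin 3 → Bool, a ≤ b → b ∈ Y) →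
      (∑ x ∈ X, μ x) * (∑ x ∈ Y ∩ ({![true, true, false], ![true, false, true], ![true, true, true]} : Finset (Fin 3 → Bool)), μ x) + (∑ x ∈ Y, μ x) * (∑ x ∈ X ∩ ({![true, true, false], ![true, false, true], ![true, true, true]} : Finset (Fin 3 → Bool)), μ x) - (∑ x ∈ ({![true, true, false], ![true, false, true], ![true, true, true]} : Finset (Fin 3 → Bool)), μ x) * (∑ x ∈ X, μ x) * (∑ x ∈ Y, μ x)
        ≤ ∑ x ∈ (X ∩ Y) ∩ ({![true, true, false], ![true, false, true], ![true, true, true]} : Finset (Fin 3 → Bool)), R x)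
    (P K L O P' K' L' O' : Finset (Fin 3 → Bool))
    (hP : (∀ a ∈ P, ∀ b : Fin 3 → Bool, a ≤ b → b ∈ P)) (hK : (∀ a ∈ K, ∀ b : Fin 3 → Bool, a ≤ b → b ∈ K))
    (hL : (∀ a ∈ L, ∀ b : Fin 3 → Bool, a ≤ b → b ∈ L)) (hO : (∀ a ∈ O, ∀ b : Fin 3 → Bool, a ≤ b → b ∈ O))
    (hP' : (∀ a ∈ P', ∀ b : Fin 3 → Bool, a ≤ b → b ∈ P')) (hK' : (∀ a ∈ K', ∀ b : Fin 3 → Bool, a ≤ b → b ∈ K'))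
    (hL' : (∀ a ∈ L', ∀ b : Fin 3 → Bool, a ≤ b → b ∈ L')) (hO' : (∀ a ∈ O', ∀ b : Fin 3 → Bool, a ≤ b → b ∈ O'))
    (hKP : K ⊆ P) (hLP : L ⊆ P) (hOK : O ⊆ K) (_hOL : O ⊆ L) (hKP' : K' ⊆ P') (hLP' : L' ⊆ P') (hOK' : O' ⊆ K') (_hOL' : O' ⊆ L')
    (hΞ₁ : ((K \ L) ∩ (L' \ K')) ∩ ({![true, true, false], ![true, false, true], ![true, true, true]} : Finset (Fin 3 → Bool)) = ∅) (hΞ₂ : ((L \ K) ∩ (K' \ L')) ∩ ({![true, true, false], ![true, false, true], ![true, true, true]} : Finset (Fin 3 → Bool)) = ∅) :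
    0 ≤ (∑ x ∈ (P ∩ P') ∩ ({![true, true, false], ![true, false, true], ![true, true, true]} : Finset (Fin 3 → Bool)), μ x) + (∑ x ∈ (O ∩ O') ∩ ({![true, true, false], ![true, false, true], ![true, true, true]} : Finset (Fin 3 → Bool)), μ x)
        - (∑ x ∈ P, μ x) * (∑ x ∈ O' ∩ ({![true, true, false], ![true, false, true], ![true, true, true]} : Finset (Fin 3 → Bool)), μ x) - (∑ x ∈ P', μ x) * (∑ x ∈ O ∩ ({![true, true, false], ![true, false, true], ![true, true, true]} : Finset (Fin 3 → Bool)), μ x)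
        + (∑ x ∈ (K ∩ K') ∩ ({![true, true, false], ![true, false, true], ![true, true, true]} : Finset (Fin 3 → Bool)), R x) + (∑ x ∈ (L ∩ L') ∩ ({![true, true, false], ![true, false, true], ![true, true, true]} : Finset (Fin 3 → Bool)), R x)
        - ((∑ x ∈ K, μ x) * (∑ x ∈ L' ∩ ({![true, true, false], ![true, false, true], ![true, true, true]} : Finset (Fin 3 → Bool)), μ x) + (∑ x ∈ L', μ x) * (∑ x ∈ K ∩ ({![true, true, false], ![true, false, true], ![true, true, true]} : Finset (Fin 3 → Bool)), μ x)
            - (∑ x ∈ ({![true, true, false], ![true, false, true], ![true, true, true]} : Finset (Fin 3 → Bool)), μ x) * (∑ x ∈ K, μ x) * (∑ x ∈ L', μ x))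
        - ((∑ x ∈ L, μ x) * (∑ x ∈ K' ∩ ({![true, true, false], ![true, false, true], ![true, true, true]} : Finset (Fin 3 → Bool)), μ x) + (∑ x ∈ K', μ x) * (∑ x ∈ L ∩ ({![true, true, false], ![true, false, true], ![true, true, true]} : Finset (Fin 3 → Bool)), μ x)
            - (∑ x ∈ ({![true, true, false], ![true, false, true], ![true, true, true]} : Finset (Fin 3 → Bool)), μ x) * (∑ x ∈ L, μ x) * (∑ x ∈ K', μ x))
        + (1 - ∑ x ∈ ({![true, true, false], ![true, false, true], ![true, true, true]} : Finset (Fin 3 → Bool)), μ x) * (((∑ x ∈ P ∩ P', μ x) - (∑ x ∈ P, μ x) * (∑ x ∈ P', μ x))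
            + ((∑ x ∈ P, μ x) - ∑ x ∈ K, μ x) * ((∑ x ∈ K', μ x) - ∑ x ∈ O', μ x)
            + ((∑ x ∈ P, μ x) - ∑ x ∈ O, μ x) * ((∑ x ∈ P', μ x) - ∑ x ∈ K', μ x)) := by
  have hw := pw_nonneg A b c hA0 hA1 hb0 hb1 hc0 hc1 μ hμ
  have hw1 := pw_sum_univ A b c μ hμ
  have hHar₁ := harris_inter_V A b c hA0 hA1 hb0 hb1 hc0 hc1 μ hμ P O' hP hO'
  have hHar₂ : (∑ x ∈ P', μ x) * (∑ x ∈ O ∩ ({![true, true, false], ![true, false, true], ![true, true, true]} : Finset (Fin 3 → Bool)), μ x) ≤ ∑ x ∈ (O ∩ P') ∩ ({![true, true, false], ![true, false, true], ![true, true, true]} : Finset (Fin 3 → Bool)), μ x := by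
    have h := harris_inter_V A b c hA0 hA1 hb0 hb1 hc0 hc1 μ hμ P' O hP' hO; rwa [Finset.inter_comm P' O] at h
  have hPP := harris_plain A b c hA0 hA1 hb0 hb1 hc0 hc1 μ hμ P P' hP hP'
  have hPPV := harris_inter_V A b c hA0 hA1 hb0 hb1 hc0 hc1 μ hμ P P' hP hP'
  have hkp : ∑ x ∈ K, μ x ≤ ∑ x ∈ P, μ x := Finset.sum_le_sum_of_subset_of_nonneg hKP (fun x _ _ => hw x)
  have hlp : ∑ x ∈ L, μ x ≤ ∑ x ∈ P, μ x := Finset.sum_le_sum_of_subset_of_nonneg hLP (fun x _ _ => hw x)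
  have hkp' : ∑ x ∈ K', μ x ≤ ∑ x ∈ P', μ x := Finset.sum_le_sum_of_subset_of_nonneg hKP' (fun x _ _ => hw x)
  have hlp' : ∑ x ∈ L', μ x ≤ ∑ x ∈ P', μ x := Finset.sum_le_sum_of_subset_of_nonneg hLP' (fun x _ _ => hw x)
  have hok' : ∑ x ∈ O', μ x ≤ ∑ x ∈ K', μ x := Finset.sum_le_sum_of_subset_of_nonneg hOK' (fun x _ _ => hw x)
  have hok : ∑ x ∈ O, μ x ≤ ∑ x ∈ K, μ x := Finset.sum_le_sum_of_subset_of_nonneg hOK (fun x _ _ => hw x)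
  have hY : 0 ≤ (((∑ x ∈ P ∩ P', μ x) - (∑ x ∈ P, μ x) * (∑ x ∈ P', μ x))
            + ((∑ x ∈ P, μ x) - ∑ x ∈ K, μ x) * ((∑ x ∈ K', μ x) - ∑ x ∈ O', μ x)
            + ((∑ x ∈ P, μ x) - ∑ x ∈ O, μ x) * ((∑ x ∈ P', μ x) - ∑ x ∈ K', μ x)) :=
    add_nonneg (add_nonneg (by linarith) (mul_nonneg (by linarith) (by linarith))) (mul_nonneg (by linarith) (by linarith))
  exact exchange_of_noCross₁ μ R hw hw1 ({![true, true, false], ![true, false, true], ![true, true, true]} : Finset (Fin 3 → Bool)) K L P O K' L' P' O' (fun x _ => hR0 x) (hOK.trans hKP) hKP (hOK'.trans hKP') hOK' hKP'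
    hΞ₁ hΞ₂ (hRpair K L' hK hL') (hRpair L K' hL hK') hHar₁ hHar₂ hPP

/-- Generic empty-`K`-layer branch (`K ∩ V = ∅`, hence `K = O = ∅`), type 1: `exchange_of_emptyLayerK₁`. -/
theorem br1_emptyK (A b c : ℝ) (hA0 : 0 ≤ A) (hA1 : A ≤ 1) (hb0 : 0 ≤ b) (hb1 : b ≤ 1) (hc0 : 0 ≤ c) (hc1 : c ≤ 1)
    (μ : (Fin 3 → Bool) → ℝ) (hμ : ∀ x, μ x = (if x 0 then A else 1 - A) * ((if x 1 then b else 1 - b) * (if x 2 then c else 1 - c)))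
    (R : (Fin 3 → Bool) → ℝ) (hR0 : ∀ x, 0 ≤ R x)
    (hRpair : ∀ X Y : Finset (Fin 3 → Bool), (∀ a ∈ X, ∀ b : Fin 3 → Bool, a ≤ b → b ∈ X) → (∀ a ∈ Y, ∀ b : Fin 3 → Bool, a ≤ b → b ∈ Y) →
      (∑ x ∈ X, μ x) * (∑ x ∈ Y ∩ ({![true, true, false], ![true, false, true], ![true, true, true]} : Finset (Fin 3 → Bool)), μ x) + (∑ x ∈ Y, μ x) * (∑ x ∈ X ∩ ({![true, true, false], ![true, false, true], ![true, true, true]} : Finset (Fin 3 → Bool)), μ x) - (∑ x ∈ ({![true, true, false], ![true, false, true], ![true, true, true]} : Finset (Fin 3 → Bool)), μ x) * (∑ x ∈ X, μ x) * (∑ x ∈ Y, μ x)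
        ≤ ∑ x ∈ (X ∩ Y) ∩ ({![true, true, false], ![true, false, true], ![true, true, true]} : Finset (Fin 3 → Bool)), R x)
    (P K L O P' K' L' O' : Finset (Fin 3 → Bool))
    (hP : (∀ a ∈ P, ∀ b : Fin 3 → Bool, a ≤ b → b ∈ P)) (hK : (∀ a ∈ K, ∀ b : Fin 3 → Bool, a ≤ b → b ∈ K))
    (hL : (∀ a ∈ L, ∀ b : Fin 3 → Bool, a ≤ b → b ∈ L)) (hO : (∀ a ∈ O, ∀ b : Fin 3 → Bool, a ≤ b → b ∈ O))
    (hP' : (∀ a ∈ P', ∀ b : Fin 3 → Bool, a ≤ b → b ∈ P')) (hK' : (∀ a ∈ K', ∀ b : Fin 3 → Bool, a ≤ b → b ∈ K'))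
    (hL' : (∀ a ∈ L', ∀ b : Fin 3 → Bool, a ≤ b → b ∈ L')) (hO' : (∀ a ∈ O', ∀ b : Fin 3 → Bool, a ≤ b → b ∈ O'))
    (hKP : K ⊆ P) (hLP : L ⊆ P) (hOK : O ⊆ K) (_hOL : O ⊆ L) (hKP' : K' ⊆ P') (hLP' : L' ⊆ P') (hOK' : O' ⊆ K') (hOL' : O' ⊆ L')
    (hTK : K ∩ ({![true, true, false], ![true, false, true], ![true, true, true]} : Finset (Fin 3 → Bool)) = ∅) :
    0 ≤ (∑ x ∈ (P ∩ P') ∩ ({![true, true, false], ![true, false, true], ![true, true, true]} : Finset (Fin 3 → Bool)), μ x) + (∑ x ∈ (O ∩ O') ∩ ({![true, true, false], ![true, false, true], ![true, true, true]} : Finset (Fin 3 → Bool)), μ x)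
        - (∑ x ∈ P, μ x) * (∑ x ∈ O' ∩ ({![true, true, false], ![true, false, true], ![true, true, true]} : Finset (Fin 3 → Bool)), μ x) - (∑ x ∈ P', μ x) * (∑ x ∈ O ∩ ({![true, true, false], ![true, false, true], ![true, true, true]} : Finset (Fin 3 → Bool)), μ x)
        + (∑ x ∈ (K ∩ K') ∩ ({![true, true, false], ![true, false, true], ![true, true, true]} : Finset (Fin 3 → Bool)), R x) + (∑ x ∈ (L ∩ L') ∩ ({![true, true, false], ![true, false, true], ![true, true, true]} : Finset (Fin 3 → Bool)), R x)
        - ((∑ x ∈ K, μ x) * (∑ x ∈ L' ∩ ({![true, true, false], ![true, false, true], ![true, true, true]} : Finset (Fin 3 → Bool)), μ x) + (∑ x ∈ L', μ x) * (∑ x ∈ K ∩ ({![true, true, false], ![true, false, true], ![true, true, true]} : Finset (Fin 3 → Bool)), μ x)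
            - (∑ x ∈ ({![true, true, false], ![true, false, true], ![true, true, true]} : Finset (Fin 3 → Bool)), μ x) * (∑ x ∈ K, μ x) * (∑ x ∈ L', μ x))
        - ((∑ x ∈ L, μ x) * (∑ x ∈ K' ∩ ({![true, true, false], ![true, false, true], ![true, true, true]} : Finset (Fin 3 → Bool)), μ x) + (∑ x ∈ K', μ x) * (∑ x ∈ L ∩ ({![true, true, false], ![true, false, true], ![true, true, true]} : Finset (Fin 3 → Bool)), μ x)
            - (∑ x ∈ ({![true, true, false], ![true, false, true], ![true, true, true]} : Finset (Fin 3 → Bool)), μ x) * (∑ x ∈ L, μ x) * (∑ x ∈ K', μ x))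
        + (1 - ∑ x ∈ ({![true, true, false], ![true, false, true], ![true, true, true]} : Finset (Fin 3 → Bool)), μ x) * (((∑ x ∈ P ∩ P', μ x) - (∑ x ∈ P, μ x) * (∑ x ∈ P', μ x))
            + ((∑ x ∈ P, μ x) - ∑ x ∈ K, μ x) * ((∑ x ∈ K', μ x) - ∑ x ∈ O', μ x)
            + ((∑ x ∈ P, μ x) - ∑ x ∈ O, μ x) * ((∑ x ∈ P', μ x) - ∑ x ∈ K', μ x)) := by
  have hw := pw_nonneg A b c hA0 hA1 hb0 hb1 hc0 hc1 μ hμ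
  have hw1 := pw_sum_univ A b c μ hμ
  have hHar₁ := harris_inter_V A b c hA0 hA1 hb0 hb1 hc0 hc1 μ hμ P O' hP hO'
  have hHar₂ : (∑ x ∈ P', μ x) * (∑ x ∈ O ∩ ({![true, true, false], ![true, false, true], ![true, true, true]} : Finset (Fin 3 → Bool)), μ x) ≤ ∑ x ∈ (O ∩ P') ∩ ({![true, true, false], ![true, false, true], ![true, true, true]} : Finset (Fin 3 → Bool)), μ x := by
    have h := harris_inter_V A b c hA0 hA1 hb0 hb1 hc0 hc1 μ hμ P' O hP' hO; rwa [Finset.inter_comm P' O] at h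
  have hPP := harris_plain A b c hA0 hA1 hb0 hb1 hc0 hc1 μ hμ P P' hP hP'
  have hPPV := harris_inter_V A b c hA0 hA1 hb0 hb1 hc0 hc1 μ hμ P P' hP hP'
  have hkp : ∑ x ∈ K, μ x ≤ ∑ x ∈ P, μ x := Finset.sum_le_sum_of_subset_of_nonneg hKP (fun x _ _ => hw x)
  have hlp : ∑ x ∈ L, μ x ≤ ∑ x ∈ P, μ x := Finset.sum_le_sum_of_subset_of_nonneg hLP (fun x _ _ => hw x)
  have hkp' : ∑ x ∈ K', μ x ≤ ∑ x ∈ P', μ x := Finset.sum_le_sum_of_subset_of_nonneg hKP' (fun x _ _ => hw x)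
  have hlp' : ∑ x ∈ L', μ x ≤ ∑ x ∈ P', μ x := Finset.sum_le_sum_of_subset_of_nonneg hLP' (fun x _ _ => hw x)
  have hok' : ∑ x ∈ O', μ x ≤ ∑ x ∈ K', μ x := Finset.sum_le_sum_of_subset_of_nonneg hOK' (fun x _ _ => hw x)
  have hok : ∑ x ∈ O, μ x ≤ ∑ x ∈ K, μ x := Finset.sum_le_sum_of_subset_of_nonneg hOK (fun x _ _ => hw x)
  have hY : 0 ≤ (((∑ x ∈ P ∩ P', μ x) - (∑ x ∈ P, μ x) * (∑ x ∈ P', μ x))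
            + ((∑ x ∈ P, μ x) - ∑ x ∈ K, μ x) * ((∑ x ∈ K', μ x) - ∑ x ∈ O', μ x)
            + ((∑ x ∈ P, μ x) - ∑ x ∈ O, μ x) * ((∑ x ∈ P', μ x) - ∑ x ∈ K', μ x)) :=
    add_nonneg (add_nonneg (by linarith) (mul_nonneg (by linarith) (by linarith))) (mul_nonneg (by linarith) (by linarith))
  have h0 : K = ∅ := eq_empty_of_trace_empty K hK hTK
  have hO0 : O = ∅ := Finset.subset_empty.1 (h0 ▸ hOK)
  subst h0; subst hO0
  have h := exchange_of_emptyLayerK₁ μ R hw hw1 ({![true, true, false], ![true, false, true], ![true, true, true]} : Finset (Fin 3 → Bool)) L P K' L' P' O' (fun x _ => hR0 x) hLP hOK' hOL' hKP' hLP'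
    (hRpair L (K' ∩ L') hL (inter_up K' L' hK' hL')) hPPV hPP
  simp only [Finset.empty_inter, Finset.inter_empty, Finset.sum_empty, Finset.empty_sdiff, zero_mul, mul_zero, sub_zero, zero_sub, add_zero, zero_add, neg_zero] at h ⊢
  linarith

/-- Generic empty-`L`-layer branch (`L ∩ V = ∅`, hence `L = O = ∅`), type 1: `exchange_of_emptyLayer₁`. -/
theorem br1_emptyL (A b c : ℝ) (hA0 : 0 ≤ A) (hA1 : A ≤ 1) (hb0 : 0 ≤ b) (hb1 : b ≤ 1) (hc0 : 0 ≤ c) (hc1 : c ≤ 1)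
    (μ : (Fin 3 → Bool) → ℝ) (hμ : ∀ x, μ x = (if x 0 then A else 1 - A) * ((if x 1 then b else 1 - b) * (if x 2 then c else 1 - c)))
    (R : (Fin 3 → Bool) → ℝ) (hR0 : ∀ x, 0 ≤ R x)
    (hRpair : ∀ X Y : Finset (Fin 3 → Bool), (∀ a ∈ X, ∀ b : Fin 3 → Bool, a ≤ b → b ∈ X) → (∀ a ∈ Y, ∀ b : Fin 3 → Bool, a ≤ b → b ∈ Y) →
      (∑ x ∈ X, μ x) * (∑ x ∈ Y ∩ ({![true, true, false], ![true, false, true], ![true, true, true]} : Finset (Fin 3 → Bool)), μ x) + (∑ x ∈ Y, μ x) * (∑ x ∈ X ∩ ({![true, true, false], ![true, false, true], ![true, true, true]} : Finset (Fin 3 → Bool)), μ x) - (∑ x ∈ ({![true, true, false], ![true, false, true], ![true, true, true]} : Finset (Fin 3 → Bool)), μ x) * (∑ x ∈ X, μ x) * (∑ x ∈ Y, μ x)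
        ≤ ∑ x ∈ (X ∩ Y) ∩ ({![true, true, false], ![true, false, true], ![true, true, true]} : Finset (Fin 3 → Bool)), R x)
    (P K L O P' K' L' O' : Finset (Fin 3 → Bool))
    (hP : (∀ a ∈ P, ∀ b : Fin 3 → Bool, a ≤ b → b ∈ P)) (hK : (∀ a ∈ K, ∀ b : Fin 3 → Bool, a ≤ b → b ∈ K))
    (hL : (∀ a ∈ L, ∀ b : Fin 3 → Bool, a ≤ b → b ∈ L)) (hO : (∀ a ∈ O, ∀ b : Fin 3 → Bool, a ≤ b → b ∈ O))
    (hP' : (∀ a ∈ P', ∀ b : Fin 3 → Bool, a ≤ b → b ∈ P')) (hK' : (∀ a ∈ K', ∀ b : Fin 3 → Bool, a ≤ b → b ∈ K'))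
    (hL' : (∀ a ∈ L', ∀ b : Fin 3 → Bool, a ≤ b → b ∈ L')) (hO' : (∀ a ∈ O', ∀ b : Fin 3 → Bool, a ≤ b → b ∈ O'))
    (hKP : K ⊆ P) (hLP : L ⊆ P) (hOK : O ⊆ K) (hOL : O ⊆ L) (hKP' : K' ⊆ P') (hLP' : L' ⊆ P') (hOK' : O' ⊆ K') (hOL' : O' ⊆ L')
    (hTL : L ∩ ({![true, true, false], ![true, false, true], ![true, true, true]} : Finset (Fin 3 → Bool)) = ∅) :
    0 ≤ (∑ x ∈ (P ∩ P') ∩ ({![true, true, false], ![true, false, true], ![true, true, true]} : Finset (Fin 3 → Bool)), μ x) + (∑ x ∈ (O ∩ O') ∩ ({![true, true, false], ![true, false, true], ![true, true, true]} : Finset (Fin 3 → Bool)), μ x)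
        - (∑ x ∈ P, μ x) * (∑ x ∈ O' ∩ ({![true, true, false], ![true, false, true], ![true, true, true]} : Finset (Fin 3 → Bool)), μ x) - (∑ x ∈ P', μ x) * (∑ x ∈ O ∩ ({![true, true, false], ![true, false, true], ![true, true, true]} : Finset (Fin 3 → Bool)), μ x)
        + (∑ x ∈ (K ∩ K') ∩ ({![true, true, false], ![true, false, true], ![true, true, true]} : Finset (Fin 3 → Bool)), R x) + (∑ x ∈ (L ∩ L') ∩ ({![true, true, false], ![true, false, true], ![true, true, true]} : Finset (Fin 3 → Bool)), R x)
        - ((∑ x ∈ K, μ x) * (∑ x ∈ L' ∩ ({![true, true, false], ![true, false, true], ![true, true, true]} : Finset (Fin 3 → Bool)), μ x) + (∑ x ∈ L', μ x) * (∑ x ∈ K ∩ ({![true, true, false], ![true, false, true], ![true, true, true]} : Finset (Fin 3 → Bool)), μ x)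
            - (∑ x ∈ ({![true, true, false], ![true, false, true], ![true, true, true]} : Finset (Fin 3 → Bool)), μ x) * (∑ x ∈ K, μ x) * (∑ x ∈ L', μ x))
        - ((∑ x ∈ L, μ x) * (∑ x ∈ K' ∩ ({![true, true, false], ![true, false, true], ![true, true, true]} : Finset (Fin 3 → Bool)), μ x) + (∑ x ∈ K', μ x) * (∑ x ∈ L ∩ ({![true, true, false], ![true, false, true], ![true, true, true]} : Finset (Fin 3 → Bool)), μ x)
            - (∑ x ∈ ({![true, true, false], ![true, false, true], ![true, true, true]} : Finset (Fin 3 → Bool)), μ x) * (∑ x ∈ L, μ x) * (∑ x ∈ K', μ x))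
        + (1 - ∑ x ∈ ({![true, true, false], ![true, false, true], ![true, true, true]} : Finset (Fin 3 → Bool)), μ x) * (((∑ x ∈ P ∩ P', μ x) - (∑ x ∈ P, μ x) * (∑ x ∈ P', μ x))
            + ((∑ x ∈ P, μ x) - ∑ x ∈ K, μ x) * ((∑ x ∈ K', μ x) - ∑ x ∈ O', μ x)
            + ((∑ x ∈ P, μ x) - ∑ x ∈ O, μ x) * ((∑ x ∈ P', μ x) - ∑ x ∈ K', μ x)) := by
  have hw := pw_nonneg A b c hA0 hA1 hb0 hb1 hc0 hc1 μ hμ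
  have hw1 := pw_sum_univ A b c μ hμ
  have hHar₁ := harris_inter_V A b c hA0 hA1 hb0 hb1 hc0 hc1 μ hμ P O' hP hO'
  have hHar₂ : (∑ x ∈ P', μ x) * (∑ x ∈ O ∩ ({![true, true, false], ![true, false, true], ![true, true, true]} : Finset (Fin 3 → Bool)), μ x) ≤ ∑ x ∈ (O ∩ P') ∩ ({![true, true, false], ![true, false, true], ![true, true, true]} : Finset (Fin 3 → Bool)), μ x := by
    have h := harris_inter_V A b c hA0 hA1 hb0 hb1 hc0 hc1 μ hμ P' O hP' hO; rwa [Finset.inter_comm P' O] at h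
  have hPP := harris_plain A b c hA0 hA1 hb0 hb1 hc0 hc1 μ hμ P P' hP hP'
  have hPPV := harris_inter_V A b c hA0 hA1 hb0 hb1 hc0 hc1 μ hμ P P' hP hP'
  have hkp : ∑ x ∈ K, μ x ≤ ∑ x ∈ P, μ x := Finset.sum_le_sum_of_subset_of_nonneg hKP (fun x _ _ => hw x)
  have hlp : ∑ x ∈ L, μ x ≤ ∑ x ∈ P, μ x := Finset.sum_le_sum_of_subset_of_nonneg hLP (fun x _ _ => hw x)
  have hkp' : ∑ x ∈ K', μ x ≤ ∑ x ∈ P', μ x := Finset.sum_le_sum_of_subset_of_nonneg hKP' (fun x _ _ => hw x)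
  have hlp' : ∑ x ∈ L', μ x ≤ ∑ x ∈ P', μ x := Finset.sum_le_sum_of_subset_of_nonneg hLP' (fun x _ _ => hw x)
  have hok' : ∑ x ∈ O', μ x ≤ ∑ x ∈ K', μ x := Finset.sum_le_sum_of_subset_of_nonneg hOK' (fun x _ _ => hw x)
  have hok : ∑ x ∈ O, μ x ≤ ∑ x ∈ K, μ x := Finset.sum_le_sum_of_subset_of_nonneg hOK (fun x _ _ => hw x)
  have hY : 0 ≤ (((∑ x ∈ P ∩ P', μ x) - (∑ x ∈ P, μ x) * (∑ x ∈ P', μ x))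
            + ((∑ x ∈ P, μ x) - ∑ x ∈ K, μ x) * ((∑ x ∈ K', μ x) - ∑ x ∈ O', μ x)
            + ((∑ x ∈ P, μ x) - ∑ x ∈ O, μ x) * ((∑ x ∈ P', μ x) - ∑ x ∈ K', μ x)) :=
    add_nonneg (add_nonneg (by linarith) (mul_nonneg (by linarith) (by linarith))) (mul_nonneg (by linarith) (by linarith))
  have h0 : L = ∅ := eq_empty_of_trace_empty L hL hTL
  have hO0 : O = ∅ := Finset.subset_empty.1 (h0 ▸ hOL)
  subst h0; subst hO0
  have h := exchange_of_emptyLayer₁ μ R hw hw1 ({![true, true, false], ![true, false, true], ![true, true, true]} : Finset (Fin 3 → Bool)) K P K' L' P' O' (fun x _ => hR0 x) hKP hOK' hOL' hKP' hLP'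
    (hRpair K (K' ∩ L') hK (inter_up K' L' hK' hL')) hPPV hPP
  simp only [Finset.empty_inter, Finset.inter_empty, Finset.sum_empty, Finset.empty_sdiff, zero_mul, mul_zero, sub_zero, zero_sub, add_zero, zero_add, neg_zero] at h ⊢
  linarith

/-- Generic empty-primed-`K`-layer branch (`K' ∩ V = ∅`), type 1: `exchange_of_emptyLayerKp` with the sub-pair `(K∩L, L')`. -/
theorem br1_emptyKp (A b c : ℝ) (hA0 : 0 ≤ A) (hA1 : A ≤ 1) (hb0 : 0 ≤ b) (hb1 : b ≤ 1) (hc0 : 0 ≤ c) (hc1 : c ≤ 1)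
    (μ : (Fin 3 → Bool) → ℝ) (hμ : ∀ x, μ x = (if x 0 then A else 1 - A) * ((if x 1 then b else 1 - b) * (if x 2 then c else 1 - c)))
    (R : (Fin 3 → Bool) → ℝ) (hR0 : ∀ x, 0 ≤ R x)
    (hRpair : ∀ X Y : Finset (Fin 3 → Bool), (∀ a ∈ X, ∀ b : Fin 3 → Bool, a ≤ b → b ∈ X) → (∀ a ∈ Y, ∀ b : Fin 3 → Bool, a ≤ b → b ∈ Y) →
      (∑ x ∈ X, μ x) * (∑ x ∈ Y ∩ ({![true, true, false], ![true, false, true], ![true, true, true]} : Finset (Fin 3 → Bool)), μ x) + (∑ x ∈ Y, μ x) * (∑ x ∈ X ∩ ({![true, true, false], ![true, false, true], ![true, true, true]} : Finset (Fin 3 → Bool)), μ x) - (∑ x ∈ ({![true, true, false], ![true, false, true], ![true, true, true]} : Finset (Fin 3 → Bool)), μ x) * (∑ x ∈ X, μ x) * (∑ x ∈ Y, μ x)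
        ≤ ∑ x ∈ (X ∩ Y) ∩ ({![true, true, false], ![true, false, true], ![true, true, true]} : Finset (Fin 3 → Bool)), R x)
    (P K L O P' K' L' O' : Finset (Fin 3 → Bool))
    (hP : (∀ a ∈ P, ∀ b : Fin 3 → Bool, a ≤ b → b ∈ P)) (hK : (∀ a ∈ K, ∀ b : Fin 3 → Bool, a ≤ b → b ∈ K))
    (hL : (∀ a ∈ L, ∀ b : Fin 3 → Bool, a ≤ b → b ∈ L)) (hO : (∀ a ∈ O, ∀ b : Fin 3 → Bool, a ≤ b → b ∈ O))
    (hP' : (∀ a ∈ P', ∀ b : Fin 3 → Bool, a ≤ b → b ∈ P')) (hK' : (∀ a ∈ K', ∀ b : Fin 3 → Bool, a ≤ b → b ∈ K'))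
    (hL' : (∀ a ∈ L', ∀ b : Fin 3 → Bool, a ≤ b → b ∈ L')) (hO' : (∀ a ∈ O', ∀ b : Fin 3 → Bool, a ≤ b → b ∈ O'))
    (hKP : K ⊆ P) (hLP : L ⊆ P) (hOK : O ⊆ K) (hOL : O ⊆ L) (hKP' : K' ⊆ P') (hLP' : L' ⊆ P') (hOK' : O' ⊆ K') (_hOL' : O' ⊆ L')
    (hTK' : K' ∩ ({![true, true, false], ![true, false, true], ![true, true, true]} : Finset (Fin 3 → Bool)) = ∅) :
    0 ≤ (∑ x ∈ (P ∩ P') ∩ ({![true, true, false], ![true, false, true], ![true, true, true]} : Finset (Fin 3 → Bool)), μ x) + (∑ x ∈ (O ∩ O') ∩ ({![true, true, false], ![true, false, true], ![true, true, true]} : Finset (Fin 3 → Bool)), μ x)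
        - (∑ x ∈ P, μ x) * (∑ x ∈ O' ∩ ({![true, true, false], ![true, false, true], ![true, true, true]} : Finset (Fin 3 → Bool)), μ x) - (∑ x ∈ P', μ x) * (∑ x ∈ O ∩ ({![true, true, false], ![true, false, true], ![true, true, true]} : Finset (Fin 3 → Bool)), μ x)
        + (∑ x ∈ (K ∩ K') ∩ ({![true, true, false], ![true, false, true], ![true, true, true]} : Finset (Fin 3 → Bool)), R x) + (∑ x ∈ (L ∩ L') ∩ ({![true, true, false], ![true, false, true], ![true, true, true]} : Finset (Fin 3 → Bool)), R x)
        - ((∑ x ∈ K, μ x) * (∑ x ∈ L' ∩ ({![true, true, false], ![true, false, true], ![true, true, true]} : Finset (Fin 3 → Bool)), μ x) + (∑ x ∈ L', μ x) * (∑ x ∈ K ∩ ({![true, true, false], ![true, false, true], ![true, true, true]} : Finset (Fin 3 → Bool)), μ x)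
            - (∑ x ∈ ({![true, true, false], ![true, false, true], ![true, true, true]} : Finset (Fin 3 → Bool)), μ x) * (∑ x ∈ K, μ x) * (∑ x ∈ L', μ x))
        - ((∑ x ∈ L, μ x) * (∑ x ∈ K' ∩ ({![true, true, false], ![true, false, true], ![true, true, true]} : Finset (Fin 3 → Bool)), μ x) + (∑ x ∈ K', μ x) * (∑ x ∈ L ∩ ({![true, true, false], ![true, false, true], ![true, true, true]} : Finset (Fin 3 → Bool)), μ x)
            - (∑ x ∈ ({![true, true, false], ![true, false, true], ![true, true, true]} : Finset (Fin 3 → Bool)), μ x) * (∑ x ∈ L, μ x) * (∑ x ∈ K', μ x))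
        + (1 - ∑ x ∈ ({![true, true, false], ![true, false, true], ![true, true, true]} : Finset (Fin 3 → Bool)), μ x) * (((∑ x ∈ P ∩ P', μ x) - (∑ x ∈ P, μ x) * (∑ x ∈ P', μ x))
            + ((∑ x ∈ P, μ x) - ∑ x ∈ K, μ x) * ((∑ x ∈ K', μ x) - ∑ x ∈ O', μ x)
            + ((∑ x ∈ P, μ x) - ∑ x ∈ O, μ x) * ((∑ x ∈ P', μ x) - ∑ x ∈ K', μ x)) := by
  have hw := pw_nonneg A b c hA0 hA1 hb0 hb1 hc0 hc1 μ hμ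
  have hw1 := pw_sum_univ A b c μ hμ
  have hHar₁ := harris_inter_V A b c hA0 hA1 hb0 hb1 hc0 hc1 μ hμ P O' hP hO'
  have hHar₂ : (∑ x ∈ P', μ x) * (∑ x ∈ O ∩ ({![true, true, false], ![true, false, true], ![true, true, true]} : Finset (Fin 3 → Bool)), μ x) ≤ ∑ x ∈ (O ∩ P') ∩ ({![true, true, false], ![true, false, true], ![true, true, true]} : Finset (Fin 3 → Bool)), μ x := by
    have h := harris_inter_V A b c hA0 hA1 hb0 hb1 hc0 hc1 μ hμ P' O hP' hO; rwa [Finset.inter_comm P' O] at h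
  have hPP := harris_plain A b c hA0 hA1 hb0 hb1 hc0 hc1 μ hμ P P' hP hP'
  have hPPV := harris_inter_V A b c hA0 hA1 hb0 hb1 hc0 hc1 μ hμ P P' hP hP'
  have hkp : ∑ x ∈ K, μ x ≤ ∑ x ∈ P, μ x := Finset.sum_le_sum_of_subset_of_nonneg hKP (fun x _ _ => hw x)
  have hlp : ∑ x ∈ L, μ x ≤ ∑ x ∈ P, μ x := Finset.sum_le_sum_of_subset_of_nonneg hLP (fun x _ _ => hw x)
  have hkp' : ∑ x ∈ K', μ x ≤ ∑ x ∈ P', μ x := Finset.sum_le_sum_of_subset_of_nonneg hKP' (fun x _ _ => hw x)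
  have hlp' : ∑ x ∈ L', μ x ≤ ∑ x ∈ P', μ x := Finset.sum_le_sum_of_subset_of_nonneg hLP' (fun x _ _ => hw x)
  have hok' : ∑ x ∈ O', μ x ≤ ∑ x ∈ K', μ x := Finset.sum_le_sum_of_subset_of_nonneg hOK' (fun x _ _ => hw x)
  have hok : ∑ x ∈ O, μ x ≤ ∑ x ∈ K, μ x := Finset.sum_le_sum_of_subset_of_nonneg hOK (fun x _ _ => hw x)
  have hY : 0 ≤ (((∑ x ∈ P ∩ P', μ x) - (∑ x ∈ P, μ x) * (∑ x ∈ P', μ x))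
            + ((∑ x ∈ P, μ x) - ∑ x ∈ K, μ x) * ((∑ x ∈ K', μ x) - ∑ x ∈ O', μ x)
            + ((∑ x ∈ P, μ x) - ∑ x ∈ O, μ x) * ((∑ x ∈ P', μ x) - ∑ x ∈ K', μ x)) :=
    add_nonneg (add_nonneg (by linarith) (mul_nonneg (by linarith) (by linarith))) (mul_nonneg (by linarith) (by linarith))
  have hPPV' : (∑ x ∈ P', μ x) * (∑ x ∈ P ∩ ({![true, true, false], ![true, false, true], ![true, true, true]} : Finset (Fin 3 → Bool)), μ x) ≤ ∑ x ∈ (P ∩ P') ∩ ({![true, true, false], ![true, false, true], ![true, true, true]} : Finset (Fin 3 → Bool)), μ x := by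
    have h := harris_inter_V A b c hA0 hA1 hb0 hb1 hc0 hc1 μ hμ P' P hP' hP; rwa [Finset.inter_comm P' P] at h
  have hmK : ∑ x ∈ K ∩ L, μ x ≤ ∑ x ∈ K, μ x := Finset.sum_le_sum_of_subset_of_nonneg Finset.inter_subset_left (fun x _ _ => hw x)
  have hmL : ∑ x ∈ K ∩ L, μ x ≤ ∑ x ∈ L, μ x := Finset.sum_le_sum_of_subset_of_nonneg Finset.inter_subset_right (fun x _ _ => hw x)
  have hom : ∑ x ∈ O, μ x ≤ ∑ x ∈ K ∩ L, μ x := Finset.sum_le_sum_of_subset_of_nonneg (Finset.subset_inter hOK hOL) (fun x _ _ => hw x)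
  have hul : ∑ x ∈ K, μ x + ∑ x ∈ L, μ x - ∑ x ∈ K ∩ L, μ x ≤ ∑ x ∈ P, μ x := by
    have h1 := Finset.sum_union_inter (s₁ := K) (s₂ := L) (f := μ)
    have h2 : ∑ x ∈ K ∪ L, μ x ≤ ∑ x ∈ P, μ x := Finset.sum_le_sum_of_subset_of_nonneg (Finset.union_subset hKP hLP) (fun x _ _ => hw x)
    linarith
  have hl'0 : 0 ≤ ∑ x ∈ L', μ x := Finset.sum_nonneg fun x _ => hw x
  have h0 : K' = ∅ := eq_empty_of_trace_empty K' hK' hTK'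
  have hO0 : O' = ∅ := Finset.subset_empty.1 (h0 ▸ hOK')
  subst h0; subst hO0
  have hYb : ((∑ x ∈ K, μ x) - ∑ x ∈ K ∩ L, μ x) * (∑ x ∈ L', μ x) ≤ (((∑ x ∈ P ∩ P', μ x) - (∑ x ∈ P, μ x) * (∑ x ∈ P', μ x))
            + ((∑ x ∈ P, μ x) - ∑ x ∈ K, μ x) * ((∑ x ∈ (∅ : Finset (Fin 3 → Bool)), μ x) - ∑ x ∈ (∅ : Finset (Fin 3 → Bool)), μ x)
            + ((∑ x ∈ P, μ x) - ∑ x ∈ O, μ x) * ((∑ x ∈ P', μ x) - ∑ x ∈ (∅ : Finset (Fin 3 → Bool)), μ x)) := by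
    simp only [Finset.empty_inter, Finset.inter_empty, Finset.sum_empty, Finset.empty_sdiff, zero_mul, mul_zero, sub_zero, zero_sub, add_zero, zero_add, neg_zero]
    nlinarith [mul_le_mul (show (∑ x ∈ K, μ x) - ∑ x ∈ K ∩ L, μ x ≤ (∑ x ∈ P, μ x) - ∑ x ∈ O, μ x by linarith) hlp' hl'0 (by linarith), mul_nonneg (show 0 ≤ (∑ x ∈ P, μ x) - ∑ x ∈ K, μ x by linarith) (show 0 ≤ (∑ x ∈ P', μ x) - ∑ x ∈ L', μ x by linarith)]
  have h := exchange_of_emptyLayerKp μ R hw hw1 ({![true, true, false], ![true, false, true], ![true, true, true]} : Finset (Fin 3 → Bool)) K L P O L' P' _ (fun x _ => hR0 x) hOK hOL hKP hLP'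
    (hRpair (K ∩ L) L' (inter_up K L hK hL) hL') hPPV' hYb
  simp only [Finset.empty_inter, Finset.inter_empty, Finset.sum_empty, Finset.empty_sdiff, zero_mul, mul_zero, sub_zero, zero_sub, add_zero, zero_add, neg_zero] at h ⊢
  linarith

/-- Generic empty-primed-`L`-layer branch (`L' ∩ V = ∅`), type 1: `exchange_of_emptyLayerLp` with the sub-pair `(K∩L, K')`. -/
theorem br1_emptyLp (A b c : ℝ) (hA0 : 0 ≤ A) (hA1 : A ≤ 1) (hb0 : 0 ≤ b) (hb1 : b ≤ 1) (hc0 : 0 ≤ c) (hc1 : c ≤ 1)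
    (μ : (Fin 3 → Bool) → ℝ) (hμ : ∀ x, μ x = (if x 0 then A else 1 - A) * ((if x 1 then b else 1 - b) * (if x 2 then c else 1 - c)))
    (R : (Fin 3 → Bool) → ℝ) (hR0 : ∀ x, 0 ≤ R x)
    (hRpair : ∀ X Y : Finset (Fin 3 → Bool), (∀ a ∈ X, ∀ b : Fin 3 → Bool, a ≤ b → b ∈ X) → (∀ a ∈ Y, ∀ b : Fin 3 → Bool, a ≤ b → b ∈ Y) →
      (∑ x ∈ X, μ x) * (∑ x ∈ Y ∩ ({![true, true, false], ![true, false, true], ![true, true, true]} : Finset (Fin 3 → Bool)), μ x) + (∑ x ∈ Y, μ x) * (∑ x ∈ X ∩ ({![true, true, false], ![true, false, true], ![true, true, true]} : Finset (Fin 3 → Bool)), μ x) - (∑ x ∈ ({![true, true, false], ![true, false, true], ![true, true, true]} : Finset (Fin 3 → Bool)), μ x) * (∑ x ∈ X, μ x) * (∑ x ∈ Y, μ x)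
        ≤ ∑ x ∈ (X ∩ Y) ∩ ({![true, true, false], ![true, false, true], ![true, true, true]} : Finset (Fin 3 → Bool)), R x)
    (P K L O P' K' L' O' : Finset (Fin 3 → Bool))
    (hP : (∀ a ∈ P, ∀ b : Fin 3 → Bool, a ≤ b → b ∈ P)) (hK : (∀ a ∈ K, ∀ b : Fin 3 → Bool, a ≤ b → b ∈ K))
    (hL : (∀ a ∈ L, ∀ b : Fin 3 → Bool, a ≤ b → b ∈ L)) (hO : (∀ a ∈ O, ∀ b : Fin 3 → Bool, a ≤ b → b ∈ O))
    (hP' : (∀ a ∈ P', ∀ b : Fin 3 → Bool, a ≤ b → b ∈ P')) (hK' : (∀ a ∈ K', ∀ b : Fin 3 → Bool, a ≤ b → b ∈ K'))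
    (hL' : (∀ a ∈ L', ∀ b : Fin 3 → Bool, a ≤ b → b ∈ L')) (hO' : (∀ a ∈ O', ∀ b : Fin 3 → Bool, a ≤ b → b ∈ O'))
    (hKP : K ⊆ P) (hLP : L ⊆ P) (hOK : O ⊆ K) (hOL : O ⊆ L) (hKP' : K' ⊆ P') (hLP' : L' ⊆ P') (hOK' : O' ⊆ K') (hOL' : O' ⊆ L')
    (hTL' : L' ∩ ({![true, true, false], ![true, false, true], ![true, true, true]} : Finset (Fin 3 → Bool)) = ∅) :
    0 ≤ (∑ x ∈ (P ∩ P') ∩ ({![true, true, false], ![true, false, true], ![true, true, true]} : Finset (Fin 3 → Bool)), μ x) + (∑ x ∈ (O ∩ O') ∩ ({![true, true, false], ![true, false, true], ![true, true, true]} : Finset (Fin 3 → Bool)), μ x)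
        - (∑ x ∈ P, μ x) * (∑ x ∈ O' ∩ ({![true, true, false], ![true, false, true], ![true, true, true]} : Finset (Fin 3 → Bool)), μ x) - (∑ x ∈ P', μ x) * (∑ x ∈ O ∩ ({![true, true, false], ![true, false, true], ![true, true, true]} : Finset (Fin 3 → Bool)), μ x)
        + (∑ x ∈ (K ∩ K') ∩ ({![true, true, false], ![true, false, true], ![true, true, true]} : Finset (Fin 3 → Bool)), R x) + (∑ x ∈ (L ∩ L') ∩ ({![true, true, false], ![true, false, true], ![true, true, true]} : Finset (Fin 3 → Bool)), R x)
        - ((∑ x ∈ K, μ x) * (∑ x ∈ L' ∩ ({![true, true, false], ![true, false, true], ![true, true, true]} : Finset (Fin 3 → Bool)), μ x) + (∑ x ∈ L', μ x) * (∑ x ∈ K ∩ ({![true, true, false], ![true, false, true], ![true, true, true]} : Finset (Fin 3 → Bool)), μ x)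
            - (∑ x ∈ ({![true, true, false], ![true, false, true], ![true, true, true]} : Finset (Fin 3 → Bool)), μ x) * (∑ x ∈ K, μ x) * (∑ x ∈ L', μ x))
        - ((∑ x ∈ L, μ x) * (∑ x ∈ K' ∩ ({![true, true, false], ![true, false, true], ![true, true, true]} : Finset (Fin 3 → Bool)), μ x) + (∑ x ∈ K', μ x) * (∑ x ∈ L ∩ ({![true, true, false], ![true, false, true], ![true, true, true]} : Finset (Fin 3 → Bool)), μ x)
            - (∑ x ∈ ({![true, true, false], ![true, false, true], ![true, true, true]} : Finset (Fin 3 → Bool)), μ x) * (∑ x ∈ L, μ x) * (∑ x ∈ K', μ x))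
        + (1 - ∑ x ∈ ({![true, true, false], ![true, false, true], ![true, true, true]} : Finset (Fin 3 → Bool)), μ x) * (((∑ x ∈ P ∩ P', μ x) - (∑ x ∈ P, μ x) * (∑ x ∈ P', μ x))
            + ((∑ x ∈ P, μ x) - ∑ x ∈ K, μ x) * ((∑ x ∈ K', μ x) - ∑ x ∈ O', μ x)
            + ((∑ x ∈ P, μ x) - ∑ x ∈ O, μ x) * ((∑ x ∈ P', μ x) - ∑ x ∈ K', μ x)) := by
  have hw := pw_nonneg A b c hA0 hA1 hb0 hb1 hc0 hc1 μ hμ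
  have hw1 := pw_sum_univ A b c μ hμ
  have hHar₁ := harris_inter_V A b c hA0 hA1 hb0 hb1 hc0 hc1 μ hμ P O' hP hO'
  have hHar₂ : (∑ x ∈ P', μ x) * (∑ x ∈ O ∩ ({![true, true, false], ![true, false, true], ![true, true, true]} : Finset (Fin 3 → Bool)), μ x) ≤ ∑ x ∈ (O ∩ P') ∩ ({![true, true, false], ![true, false, true], ![true, true, true]} : Finset (Fin 3 → Bool)), μ x := by
    have h := harris_inter_V A b c hA0 hA1 hb0 hb1 hc0 hc1 μ hμ P' O hP' hO; rwa [Finset.inter_comm P' O] at h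
  have hPP := harris_plain A b c hA0 hA1 hb0 hb1 hc0 hc1 μ hμ P P' hP hP'
  have hPPV := harris_inter_V A b c hA0 hA1 hb0 hb1 hc0 hc1 μ hμ P P' hP hP'
  have hkp : ∑ x ∈ K, μ x ≤ ∑ x ∈ P, μ x := Finset.sum_le_sum_of_subset_of_nonneg hKP (fun x _ _ => hw x)
  have hlp : ∑ x ∈ L, μ x ≤ ∑ x ∈ P, μ x := Finset.sum_le_sum_of_subset_of_nonneg hLP (fun x _ _ => hw x)
  have hkp' : ∑ x ∈ K', μ x ≤ ∑ x ∈ P', μ x := Finset.sum_le_sum_of_subset_of_nonneg hKP' (fun x _ _ => hw x)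
  have hlp' : ∑ x ∈ L', μ x ≤ ∑ x ∈ P', μ x := Finset.sum_le_sum_of_subset_of_nonneg hLP' (fun x _ _ => hw x)
  have hok' : ∑ x ∈ O', μ x ≤ ∑ x ∈ K', μ x := Finset.sum_le_sum_of_subset_of_nonneg hOK' (fun x _ _ => hw x)
  have hok : ∑ x ∈ O, μ x ≤ ∑ x ∈ K, μ x := Finset.sum_le_sum_of_subset_of_nonneg hOK (fun x _ _ => hw x)
  have hY : 0 ≤ (((∑ x ∈ P ∩ P', μ x) - (∑ x ∈ P, μ x) * (∑ x ∈ P', μ x))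
            + ((∑ x ∈ P, μ x) - ∑ x ∈ K, μ x) * ((∑ x ∈ K', μ x) - ∑ x ∈ O', μ x)
            + ((∑ x ∈ P, μ x) - ∑ x ∈ O, μ x) * ((∑ x ∈ P', μ x) - ∑ x ∈ K', μ x)) :=
    add_nonneg (add_nonneg (by linarith) (mul_nonneg (by linarith) (by linarith))) (mul_nonneg (by linarith) (by linarith))
  have hPPV' : (∑ x ∈ P', μ x) * (∑ x ∈ P ∩ ({![true, true, false], ![true, false, true], ![true, true, true]} : Finset (Fin 3 → Bool)), μ x) ≤ ∑ x ∈ (P ∩ P') ∩ ({![true, true, false], ![true, false, true], ![true, true, true]} : Finset (Fin 3 → Bool)), μ x := by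
    have h := harris_inter_V A b c hA0 hA1 hb0 hb1 hc0 hc1 μ hμ P' P hP' hP; rwa [Finset.inter_comm P' P] at h
  have hmK : ∑ x ∈ K ∩ L, μ x ≤ ∑ x ∈ K, μ x := Finset.sum_le_sum_of_subset_of_nonneg Finset.inter_subset_left (fun x _ _ => hw x)
  have hmL : ∑ x ∈ K ∩ L, μ x ≤ ∑ x ∈ L, μ x := Finset.sum_le_sum_of_subset_of_nonneg Finset.inter_subset_right (fun x _ _ => hw x)
  have hom : ∑ x ∈ O, μ x ≤ ∑ x ∈ K ∩ L, μ x := Finset.sum_le_sum_of_subset_of_nonneg (Finset.subset_inter hOK hOL) (fun x _ _ => hw x)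
  have hul : ∑ x ∈ K, μ x + ∑ x ∈ L, μ x - ∑ x ∈ K ∩ L, μ x ≤ ∑ x ∈ P, μ x := by
    have h1 := Finset.sum_union_inter (s₁ := K) (s₂ := L) (f := μ)
    have h2 : ∑ x ∈ K ∪ L, μ x ≤ ∑ x ∈ P, μ x := Finset.sum_le_sum_of_subset_of_nonneg (Finset.union_subset hKP hLP) (fun x _ _ => hw x)
    linarith
  have hk'0 : 0 ≤ ∑ x ∈ K', μ x := Finset.sum_nonneg fun x _ => hw x
  have h0 : L' = ∅ := eq_empty_of_trace_empty L' hL' hTL'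
  have hO0 : O' = ∅ := Finset.subset_empty.1 (h0 ▸ hOL')
  subst h0; subst hO0
  have hYb : ((∑ x ∈ L, μ x) - ∑ x ∈ K ∩ L, μ x) * (∑ x ∈ K', μ x) ≤ (((∑ x ∈ P ∩ P', μ x) - (∑ x ∈ P, μ x) * (∑ x ∈ P', μ x))
            + ((∑ x ∈ P, μ x) - ∑ x ∈ K, μ x) * ((∑ x ∈ K', μ x) - ∑ x ∈ (∅ : Finset (Fin 3 → Bool)), μ x)
            + ((∑ x ∈ P, μ x) - ∑ x ∈ O, μ x) * ((∑ x ∈ P', μ x) - ∑ x ∈ K', μ x)) := by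
    simp only [Finset.empty_inter, Finset.inter_empty, Finset.sum_empty, Finset.empty_sdiff, zero_mul, mul_zero, sub_zero, zero_sub, add_zero, zero_add, neg_zero]
    nlinarith [mul_le_mul (show (∑ x ∈ L, μ x) - ∑ x ∈ K ∩ L, μ x ≤ (∑ x ∈ P, μ x) - ∑ x ∈ K, μ x by linarith) hkp' hk'0 (by linarith), mul_nonneg (show 0 ≤ (∑ x ∈ P, μ x) - ∑ x ∈ L, μ x by linarith) (show 0 ≤ (∑ x ∈ P', μ x) - ∑ x ∈ K', μ x by linarith),
      mul_nonneg (show 0 ≤ (∑ x ∈ P, μ x) - ∑ x ∈ O, μ x by linarith) (show 0 ≤ (∑ x ∈ P', μ x) - ∑ x ∈ K', μ x by linarith)]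
  have h := exchange_of_emptyLayerLp μ R hw hw1 ({![true, true, false], ![true, false, true], ![true, true, true]} : Finset (Fin 3 → Bool)) K L P O K' P' _ (fun x _ => hR0 x) hOK hOL hLP hKP'
    (hRpair (K ∩ L) K' (inter_up K L hK hL) hK') hPPV' hYb
  simp only [Finset.empty_inter, Finset.inter_empty, Finset.sum_empty, Finset.empty_sdiff, zero_mul, mul_zero, sub_zero, zero_sub, add_zero, zero_add, neg_zero] at h ⊢
  linarith


end Summit.CriticalPhenomena.PercolationContinuityZ3.Theorems.SahiE3AndOrExch1
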